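import Literature.NumberTheory.Transcendental.PhilipponCriterionCut
import Literature.NumberTheory.Transcendental.NesterenkoEliminationProp411Holds
import Literature.NumberTheory.Transcendental.NesterenkoEliminationProp47Holds
import Literature.NumberTheory.Transcendental.NesterenkoEliminationProp413Holds
import HarnessLib

/-!
# One step of the descent: cutting a small prime by a small form and selecting a small prime component (toolkit for `CycleAPIAt 3`)

Crux `Summit.Schanuel.Schanuel.Theses.DiophantineDichotomy.ApproximationProperty`
(stmt-Schanuel-6117), line `orbit-interpolation-determinant`, registered stub `CycleAPIAt3 : CycleAPIAt 3`
(siege, elimination-theoretic variation). The `t = 2` descent (landed stubs B, F) cuts ONCE below a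
hypersurface and never has to select a prime of intermediate rank; the `t = 3` descent must pass
from the small prime SURFACE `𝔭₁ = (Q₁)` (rank `3`) through a cut `J₂` by the second small form `R₂`
to a small prime CURVE `𝔭₂ ⊇ (Q₁, R₂)` (rank `2`) before the third cut. This file packages that step
once, in every ambient dimension `m` and every rank `r ≥ 2`, out of the tree's PROVED elimination
theory:

* LNM 1752 Ch. 3 Prop. 4.11 (`NesterenkoPhilippon2001_ch3_prop_4_11_holds`): the cut `J` of rank
  `r − 1`, `V(J) = V((𝔭, P))`, `deg J ≤ deg 𝔭 · d`, `h(J) ≤ h(𝔭) d + h(P) deg 𝔭 + m(r+1) deg 𝔭 d`,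
  `|J(ω̄)| ≤ δ · exp(h(P) deg 𝔭 + h(𝔭) d + 11 m² deg 𝔭 d)` with `δ ≤ max(‖P‖_ω̄, |𝔭(ω̄)|)`
  (`bezoutDelta_le_max`);
* Prop. 4.7 + the weighted pigeonhole (`PhilipponMain.exists_component_le_exp`,
  `NesterenkoPhilippon2001_ch3_prop_4_7_holds`): a component `𝔮 = √Q` of a reduced primary
  decomposition of `J` inheriting the share `(w_a h(𝔮) + w_b deg 𝔮)/T` of the smallness;
* `PhilipponMain.cut_component_facts` (projective Nullstellensatz, equality of primes of equal rank,
  Prop. 4.7 1), 2)): `𝔭 ⊆ 𝔮`, `P ∈ 𝔮`, `deg 𝔮 ≤ deg 𝔭 · d`,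
  `h(𝔮) ≤ h(𝔭) d + h(P) deg 𝔭 + (m(r+1) + m²) deg 𝔭 d`; `V(𝔮) ≠ ∅` by Prop. 4.13
  (`NesterenkoPhilippon2001_ch3_prop_4_13_holds`).

Main statement `small_prime_of_cut` (registered helper stub): for a homogeneous prime `𝔭` of rank
`r` (`2 ≤ r ≤ m`), a form `P ∉ 𝔭` of degree `d ≥ 1`, `ω̄ ≠ 0`, weights `w_a, w_b ≥ 0` with
`w_a + w_b > 0`, and `U` with `max(‖P‖_ω̄, |𝔭(ω̄)|) · exp(h(P) deg 𝔭 + h(𝔭) d + 11 m² deg 𝔭 d) ≤ e^{−U}`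
and `2 m³ deg 𝔭 · d ≤ U`, there is a homogeneous prime `𝔮 ⊇ 𝔭`, `𝔮 ∋ P`, of rank `r − 1` with the
degree and height bounds above and
`|𝔮(ω̄)| ≤ exp(−(U / 2T₀) · (w_a h(𝔮) + w_b deg 𝔮))`,
`T₀ = w_a (h(𝔭) d + h(P) deg 𝔭 + (m(r+1) + m²) deg 𝔭 d) + w_b deg 𝔭 d` (an a-priori bound for the
total weight of the components of `J`). Proofs only: no new definitions.
Sources: Nesterenko–Philippon (eds.), LNM 1752 (2001), Ch. 3 Prop. 4.7, 4.11, 4.13; Philippon,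
Publ. Math. IHÉS 64 (1986) §3 (Lemme 2.14: the same step inside the criterion).
-/

set_option linter.dupNamespace false

noncomputable section

namespace Summit.Schanuel.Schanuel.Cruxes.ApproximationProperty.OrbitInterpolationDeterminant

open Literature.NumberTheory.Transcendental Literature.NumberTheory.Transcendental.Nesterenko
open Literature.NumberTheory.Transcendental.PhilipponMain MvPolynomial Real
open scoped BigOperators

namespace DescentCut

/-- Arithmetic of the exponent: if `D ≤ U/2`, `T₀ > 0` and `s ≥ 0` then
`exp(−((U − D)/T₀) s) ≤ exp(−(U/(2T₀)) s)`. [folklore] -/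
theorem exp_share_le {U D T₀ s : ℝ} (hT₀ : 0 < T₀) (hD : D ≤ U / 2) (hs : 0 ≤ s) :
    exp (-((U - D) / T₀) * s) ≤ exp (-(U / (2 * T₀)) * s) := by
  rw [exp_le_exp]
  have h1 : U / (2 * T₀) ≤ (U - D) / T₀ := by
    rw [div_le_div_iff₀ (by positivity) hT₀]
    nlinarith
  nlinarith [mul_le_mul_of_nonneg_right h1 hs]

end DescentCut

/-- **One step of the descent (cut + selection).** Let `𝔭 ⊂ ℚ[x₀, …, x_m]` be a homogeneous prime
of rank `r`, `2 ≤ r ≤ m`, `P ∉ 𝔭` a form of degree `d ≥ 1`, `ω̄ ∈ ℂ^{m+1} ∖ 0`, weights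
`w_a, w_b ≥ 0` with `w_a + w_b > 0`, and `U` with
`max(‖P‖_ω̄, |𝔭(ω̄)|) · exp(h(P) deg 𝔭 + h(𝔭) d + 11 m² deg 𝔭 d) ≤ e^{−U}` and `2 m³ deg 𝔭 d ≤ U`.
Then some homogeneous prime `𝔮` of rank `r − 1` has `𝔭 ⊆ 𝔮`, `P ∈ 𝔮`, `deg 𝔮 ≤ deg 𝔭 · d`,
`h(𝔮) ≤ h(𝔭) d + h(P) deg 𝔭 + (m(r+1) + m²) deg 𝔭 d` and
`|𝔮(ω̄)| ≤ exp(−(U/(2T₀)) (w_a h(𝔮) + w_b deg 𝔮))`,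
`T₀ = w_a (h(𝔭) d + h(P) deg 𝔭 + (m(r+1) + m²) deg 𝔭 d) + w_b deg 𝔭 d`
(Prop. 4.11 ⟶ cut `J`; Prop. 4.7 + weighted pigeonhole ⟶ component; Prop. 4.13 + projective
Nullstellensatz ⟶ containments and bounds).
[cite: NesterenkoPhilippon2001, Ch. 3 Prop. 4.7, Prop. 4.11, Prop. 4.13 (pp. 39–41)]
[cite: Philippon1986Criteres, §3 Lemme 2.14 (pp. 43–45)] -/
theorem small_prime_of_cut : ∀ (m r : ℕ) (𝔭 : Ideal (Rx m)) (P : Rx m) (d : ℕ)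
    (ω : Fin (m + 1) → ℂ) (wa wb U : ℝ), 2 ≤ r → r ≤ m → 𝔭.IsPrime →
    (letI := MvPolynomial.gradedAlgebra (σ := Fin (m + 1)) (R := ℚ);
      𝔭.IsHomogeneous (homogeneousSubmodule (Fin (m + 1)) ℚ)) →
    IsUnmixedOfRank 𝔭 r → P.IsHomogeneous d → 1 ≤ d → P ∉ 𝔭 → ω ≠ 0 → 0 ≤ wa → 0 ≤ wb →
    0 < wa + wb →
    max (normAt ω P) (iabs 𝔭 r ω) *
        Real.exp (height P * ideg 𝔭 r + iheight 𝔭 r * d + 11 * (m : ℝ) ^ 2 * ideg 𝔭 r * d) ≤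
      Real.exp (-U) →
    2 * (m : ℝ) ^ 3 * (ideg 𝔭 r * d) ≤ U →
    ∃ 𝔮 : Ideal (Rx m), 𝔮.IsPrime ∧
      (letI := MvPolynomial.gradedAlgebra (σ := Fin (m + 1)) (R := ℚ);
        𝔮.IsHomogeneous (homogeneousSubmodule (Fin (m + 1)) ℚ)) ∧
      IsUnmixedOfRank 𝔮 (r - 1) ∧ 𝔭 ≤ 𝔮 ∧ P ∈ 𝔮 ∧
      ideg 𝔮 (r - 1) ≤ ideg 𝔭 r * d ∧
      iheight 𝔮 (r - 1) ≤ iheight 𝔭 r * d + height P * ideg 𝔭 r +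
        ((m : ℝ) * (r + 1) + (m : ℝ) ^ 2) * ideg 𝔭 r * d ∧
      iabs 𝔮 (r - 1) ω ≤
        Real.exp (-(U / (2 * (wa * (iheight 𝔭 r * d + height P * ideg 𝔭 r +
            ((m : ℝ) * (r + 1) + (m : ℝ) ^ 2) * ideg 𝔭 r * d) + wb * (ideg 𝔭 r * d)))) *
          (wa * iheight 𝔮 (r - 1) + wb * ideg 𝔮 (r - 1))) := by
  intro m r 𝔭 P d ω wa wb U hr2 hrm h𝔭 h𝔭hom h𝔭unm hP hd hP𝔭 hω hwa hwb hwab hsmall hU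
  classical
  letI := MvPolynomial.gradedAlgebra (σ := Fin (m + 1)) (R := ℚ)
  have hr1 : 1 ≤ r - 1 := by omega
  have hrm' : r - 1 ≤ m := by omega
  have h47 := NesterenkoPhilippon2001_ch3_prop_4_7_holds
  have h411 := NesterenkoPhilippon2001_ch3_prop_4_11_holds
  have h413 := NesterenkoPhilippon2001_ch3_prop_4_13_holds
  have h44 := NesterenkoPhilippon2001_ch3_prop_4_4_holds
  -- the cut `J` of Prop. 4.11
  obtain ⟨J, hJhom, hJunm, hJV, hJdeg, hJh, hJabs⟩ :=
    (h411 m r 𝔭 P d (by omega) hrm h𝔭 h𝔭hom h𝔭unm hP hd hP𝔭).1 hr2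
  -- abbreviations
  set D : ℝ := (ideg 𝔭 r : ℝ) * d with hDdef
  set H : ℝ := iheight 𝔭 r * d + height P * ideg 𝔭 r +
    ((m : ℝ) * (r + 1) + (m : ℝ) ^ 2) * ideg 𝔭 r * d with hHdef
  set T₀ : ℝ := wa * H + wb * D with hT₀def
  have hdeg1 : 1 ≤ ideg 𝔭 r :=
    Literature.Barriers.Schanuel.one_le_ideg_of_isPrime h44 (by omega) hrm h𝔭 h𝔭hom h𝔭unm
  have hdegR : (1 : ℝ) ≤ ideg 𝔭 r := by exact_mod_cast hdeg1
  have hdR : (1 : ℝ) ≤ d := by exact_mod_cast hd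
  have hD1 : 1 ≤ D := by rw [hDdef]; nlinarith
  have hhP : 0 ≤ height P := height_nonneg _
  have hh𝔭 : 0 ≤ iheight 𝔭 r := height_nonneg _
  have hm1 : (1 : ℝ) ≤ m := by exact_mod_cast (show 1 ≤ m by omega)
  have hHD : D ≤ H := by
    rw [hHdef, hDdef]
    have h1 : (1 : ℝ) ≤ (m : ℝ) * (r + 1) + (m : ℝ) ^ 2 := by
      have hr0 : (0 : ℝ) ≤ r := Nat.cast_nonneg _
      nlinarith
    have h2 : 0 ≤ (ideg 𝔭 r : ℝ) * d := by positivity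
    have h3 : 0 ≤ iheight 𝔭 r * d := by positivity
    have h4 : 0 ≤ height P * ideg 𝔭 r := by positivity
    nlinarith
  have hT₀ : 0 < T₀ := by
    rw [hT₀def]
    rcases lt_or_ge 0 wa with hwa' | hwa'
    · have : 0 ≤ wb * D := mul_nonneg hwb (by linarith)
      nlinarith
    · have hwa0 : wa = 0 := le_antisymm hwa' hwa
      have hwb' : 0 < wb := by linarith
      rw [hwa0, zero_mul, zero_add]
      exact mul_pos hwb' (by linarith)
  -- the numeric data of `J`
  have hJdegR : (ideg J (r - 1) : ℝ) ≤ D := by rw [hDdef]; exact_mod_cast hJdeg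
  have hJsmall : iabs J (r - 1) ω ≤ exp (-U) := by
    refine le_trans (hJabs ω hω) (le_trans ?_ hsmall)
    exact mul_le_mul_of_nonneg_right (bezoutDelta_le_max 𝔭 r P ω) (exp_pos _).le
  have hm3J : (m : ℝ) ^ 3 * ideg J (r - 1) ≤ U / 2 := by
    have h1 : (m : ℝ) ^ 3 * ideg J (r - 1) ≤ (m : ℝ) ^ 3 * D :=
      mul_le_mul_of_nonneg_left hJdegR (by positivity)
    rw [hDdef] at h1; linarith
  have hU0 : 0 ≤ U := by
    have : (0 : ℝ) ≤ (m : ℝ) ^ 3 * ideg J (r - 1) := by positivity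
    linarith
  have hUJ : (m : ℝ) ^ 3 * ideg J (r - 1) ≤ U := by linarith
  have hTle : wa * (iheight J (r - 1) + (m : ℝ) ^ 2 * ideg J (r - 1)) + wb * ideg J (r - 1) ≤ T₀ := by
    rw [hT₀def]
    have h1 : iheight J (r - 1) + (m : ℝ) ^ 2 * ideg J (r - 1) ≤ H := by
      rw [hHdef]
      have h2 : (m : ℝ) ^ 2 * ideg J (r - 1) ≤ (m : ℝ) ^ 2 * D :=
        mul_le_mul_of_nonneg_left hJdegR (by positivity)
      rw [hDdef] at h2
      nlinarith [hJh]
    have h3 := mul_le_mul_of_nonneg_left h1 hwa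
    have h4 := mul_le_mul_of_nonneg_left hJdegR hwb
    linarith
  -- reduced primary decomposition of `J` and the weighted pigeonhole
  obtain ⟨t, ht⟩ : ∃ t : Finset (Ideal (Rx m)), Submodule.IsMinimalPrimaryDecomposition J t :=
    Submodule.IsLasker.exists_isMinimalPrimaryDecomposition (Submodule.isLasker _ _) J
  obtain ⟨Q, hQ, hQsmall⟩ := exists_component_le_exp h47 hr1 hrm' hJhom hJunm ht hω hwa hT₀ hTle
    hUJ hJsmall
  -- the component `𝔮 = √Q`
  obtain ⟨hqprime, hqhom, hqunm, -, -⟩ :=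
    Literature.Barriers.Schanuel.radical_component_facts hJhom hJunm ht hQ
  have hne : (projZeros Q.radical).Nonempty := by
    obtain ⟨β, hβ, -⟩ := h413 m (r - 1) Q.radical hr1 hrm' hqhom hqunm ω hω
    exact ⟨β, hβ⟩
  obtain ⟨h𝔭le, hPmem, hqdeg, hqh⟩ := cut_component_facts h47 h411 hr2 hrm h𝔭 h𝔭hom h𝔭unm hP hP𝔭
    hJhom hJunm hJV ht hQ hne
  refine ⟨Q.radical, hqprime, hqhom, hqunm, h𝔭le, hPmem, hqdeg, hqh, hQsmall.trans ?_⟩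
  -- the share of the smallness
  have hs : 0 ≤ wa * iheight Q.radical (r - 1) + wb * ideg Q.radical (r - 1) :=
    add_nonneg (mul_nonneg hwa (height_nonneg _)) (mul_nonneg hwb (Nat.cast_nonneg _))
  have key := DescentCut.exp_share_le
    (s := wa * iheight Q.radical (r - 1) + wb * ideg Q.radical (r - 1)) hT₀ hm3J hs
  rw [hT₀def, hHdef, hDdef] at key
  exact key

end Summit.Schanuel.Schanuel.Cruxes.ApproximationProperty.OrbitInterpolationDeterminant

end
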